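import Summits.CriticalPhenomena.Ising3DConformalLimit.Theses.EnergyNotSigmaSquared
import Literature.Probability.LatticeModels.CriticalCorrWellDefined
import Literature.Probability.LatticeModels.GKSInequalities
import Literature.Probability.LatticeModels.Sweep1

/-!
# `MoebiusLimit` (item stmt-CriticalPhenomena-1344): coordinate-permutation invariance of the limit is AUTOMATIC

Structural knowledge about the crux `…Theses.EnergyNotSigmaSquared.MoebiusLimit`
(= `PerfectScreening.MoebiusLimitExists`), standing crux disprover (D-0016); THEOREM-ONLY.

For ANY pointwise scaling limit `S` of the critical correlators on `ℤ³` (any `ρ`, no other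
hypothesis): `S_n(P_π ∘ x) = S_n(x)` on non-coincident `x` for every coordinate permutation
`P_π : ℝ³ ≃ₗᵢ ℝ³` (`limit_coordPerm`; `P_π = LinearIsometryEquiv.piLpCongrLeft 2 ℝ ℝ π`). Here the
lattice approximation commutes EXACTLY with the permutation (`latticeApprox_coordPerm`), and the
critical state is invariant under the hyperoctahedral group of `ℤ³` (`criticalCorr_signedPerm`,
Friedli–Velenik Ex. 3.14 via the tree's `plusCorr_map_signedPerm`). So the part of
`IsRotationInvariant` carried by coordinate permutations is free; what a route must supply is the
upgrade from the cubic symmetries to all of `O(3)`.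
-/

noncomputable section

namespace Summit.CriticalPhenomena.Ising3DConformalLimit.MoebiusLimitExistsNegative

open Literature.Probability.LatticeModels Filter Set
open scoped Topology

variable {ρ : ℝ → ℝ} {S : CorrFamily 3}

/-! ### Hyperoctahedral invariance of the critical correlators on `ℤ³` -/

/-- **`⟨∏ σ_{g yᵢ}⟩_{β_c} = ⟨∏ σ_{yᵢ}⟩_{β_c}`** for every signed coordinate permutation `g` of `ℤ³`
(multiplicities allowed; spin monomials are spin products of the odd-multiplicity set).
[cite: FriedliVelenik2017, Exercise 3.14, p. 115] -/
theorem criticalCorr_signedPerm (π : Equiv.Perm (Fin 3)) (ε : Fin 3 → ℤˣ) {n : ℕ}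
    (y : Fin n → Site 3) :
    criticalCorr 3 n (fun i => Site.signedPerm π ε (y i)) = criticalCorr 3 n y := by
  classical
  obtain ⟨A, hA⟩ := exists_spinMonomial_eq_spinProduct y
  have hmap : spinMonomial (fun i => Site.signedPerm π ε (y i)) =
      spinProduct (A.map (Site.signedPerm π ε).toEmbedding) := by
    funext s
    have h1 : spinMonomial (fun i => Site.signedPerm π ε (y i)) s =
        spinMonomial y (s ∘ ⇑(Site.signedPerm π ε)) := by
      simp [spinMonomial, spinAt]
    rw [h1, show spinMonomial y (s ∘ ⇑(Site.signedPerm π ε)) =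
      spinProduct A (s ∘ ⇑(Site.signedPerm π ε)) from congrFun hA _]
    simp [spinProduct, Finset.prod_map, spinAt]
  show plusExpect 3 (criticalBeta 3) 0 (spinMonomial fun i => Site.signedPerm π ε (y i)) =
    plusExpect 3 (criticalBeta 3) 0 (spinMonomial y)
  rw [hmap, hA]
  exact plusCorr_map_signedPerm π ε (criticalBeta 3) 0 A

/-! ### Coordinate permutations of `ℝ³` commute with the lattice approximation -/

/-- Coordinates of the permuted point: `(P_π p)_j = p_{π⁻¹ j}`. [folklore] -/
theorem coordPerm_apply (π : Equiv.Perm (Fin 3)) (p : EuclideanSpace ℝ (Fin 3)) (j : Fin 3) :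
    (LinearIsometryEquiv.piLpCongrLeft 2 ℝ ℝ π p) j = p (π.symm j) := by
  simp [LinearIsometryEquiv.piLpCongrLeft_apply, Equiv.piCongrLeft'_apply]

/-- `[P_π p / δ] = g_π [p/δ]` with `g_π` the (unsigned) coordinate permutation of `ℤ³`. [folklore] -/
theorem latticeApprox_coordPerm (δ : ℝ) (π : Equiv.Perm (Fin 3)) (p : EuclideanSpace ℝ (Fin 3)) :
    latticeApprox δ (LinearIsometryEquiv.piLpCongrLeft 2 ℝ ℝ π p) =
      Site.signedPerm π 1 (latticeApprox δ p) := by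
  funext j
  rw [latticeApprox_apply, coordPerm_apply, Site.signedPerm_apply, latticeApprox_apply]
  simp

/-- The rescaled correlators are exactly invariant under coordinate permutations. [folklore] -/
theorem rescaledCorrelator_coordPerm (π : Equiv.Perm (Fin 3)) (n : ℕ) (δ : ℝ)
    (x : Fin n → EuclideanSpace ℝ (Fin 3)) :
    rescaledCorrelator (criticalCorr 3) ρ n δ (fun i => LinearIsometryEquiv.piLpCongrLeft 2 ℝ ℝ π (x i)) =
      rescaledCorrelator (criticalCorr 3) ρ n δ x := by
  rw [rescaledCorrelator_apply, rescaledCorrelator_apply]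
  congr 1
  have h : (fun i => latticeApprox δ (LinearIsometryEquiv.piLpCongrLeft 2 ℝ ℝ π (x i))) =
      fun i => Site.signedPerm π 1 (latticeApprox δ (x i)) := by
    funext i; exact latticeApprox_coordPerm δ π (x i)
  rw [h]
  exact criticalCorr_signedPerm π 1 _

/-- A linear isometry preserves non-coincidence. [folklore] -/
theorem map_mem_nonCoincident_iff {n : ℕ} (R : EuclideanSpace ℝ (Fin 3) ≃ₗᵢ[ℝ] EuclideanSpace ℝ (Fin 3))
    (x : Fin n → EuclideanSpace ℝ (Fin 3)) :
    (fun i => R (x i)) ∈ NonCoincident 3 n ↔ x ∈ NonCoincident 3 n := by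
  rw [mem_nonCoincident, mem_nonCoincident]
  exact R.injective.of_comp_iff x

/-- **Any pointwise scaling limit of the critical correlators on `ℤ³` is invariant under the
coordinate permutations of `ℝ³`** on non-coincident configurations.
[cite: FriedliVelenik2017, Exercise 3.14, p. 115] -/
theorem limit_coordPerm (hlim : HasPointwiseScalingLimit (criticalCorr 3) ρ S)
    (π : Equiv.Perm (Fin 3)) {n : ℕ} {x : Fin n → EuclideanSpace ℝ (Fin 3)}
    (hx : x ∈ NonCoincident 3 n) :
    S n (fun i => LinearIsometryEquiv.piLpCongrLeft 2 ℝ ℝ π (x i)) = S n x := by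
  have hRx := (map_mem_nonCoincident_iff (LinearIsometryEquiv.piLpCongrLeft 2 ℝ ℝ π) x).2 hx
  have h1 := (hlim n).tendsto_at hRx
  have h2 := (hlim n).tendsto_at hx
  exact tendsto_nhds_unique (h1.congr fun δ => rescaledCorrelator_coordPerm π n δ x) h2

open Classical in
/-- The normalised limit is invariant under coordinate permutations (as `O(3)` elements).
[cite: FriedliVelenik2017, Exercise 3.14, p. 115] -/
theorem normalised_coordPerm (hlim : HasPointwiseScalingLimit (criticalCorr 3) ρ S)
    (π : Equiv.Perm (Fin 3)) (n : ℕ) (x : Fin n → EuclideanSpace ℝ (Fin 3)) :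
    (fun n x => if x ∈ NonCoincident 3 n then S n x else 0) n
        (fun i => LinearIsometryEquiv.piLpCongrLeft 2 ℝ ℝ π (x i)) =
      (fun n x => if x ∈ NonCoincident 3 n then S n x else 0) n x := by
  have hiff := map_mem_nonCoincident_iff (LinearIsometryEquiv.piLpCongrLeft 2 ℝ ℝ π) x
  by_cases hx : x ∈ NonCoincident 3 n
  · simp only [if_pos (hiff.2 hx), if_pos hx, limit_coordPerm hlim π hx]
  · simp only [if_neg (mt hiff.1 hx), if_neg hx]

end Summit.CriticalPhenomena.Ising3DConformalLimit.MoebiusLimitExistsNegative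

end
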